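import Summits.Ventures.HSemireg.WedgeBoxPattern

/-!
# Venture HSemireg — the degree-n rank of the box for an arbitrary 2×2 pattern (2/2): rank = N(c)(C(2n,n) − 2) + 2 rank(c)

HONEST FRAMING. Part of the Lean index of the computation cell `pub-hsemireg` (second enclosure wave, cut by seat p6 in the
conventions of seat p3's ENCLOSURE-PLAN-p3.md / build.py from th-7's kernel assets).  Finite-dimensional exterior algebra over a field ONLY:
no variety, no cohomology theory, no semiregularity map is constructed here; nothing here says that HC / HC_CM / HC_AV holds;
no Literature fact is declared or used.  The geometric DICTIONARY (why these ranks are the `HT`-side box ranks of the cell's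
STRUCTURE.md §1 / theory/FORMULA-N.md) lives in theory/FORMULA-N-th7.md PART B §A.3 / §N and is NOT asserted in Lean.

th-7's PART G — THE DEGREE-`n` RANK FOR AN ARBITRARY `2 × 2` COEFFICIENT PATTERN (theory/th7/WeilPurity.lean v6 sha256/16 32700a71e785aa92 (th-7 g6, 23:55Z 2026-08-22; = v5 4d7ab5385cc785fa + PART G two-zero corollaries + PART W3 (= v5.1 f732a146a33beda5) + PART R4; ×2 farm + negative controls + numerics at p6 g7), the block between
Part V's `end PurityGeneral` and `end HSemiregBox`), VERBATIM up to the namespace (`HSemiregBox` ↦ `Summit.Ventures.HSemireg.WedgeBox`), file 2 of 2.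
STATEMENT (file 2, `finrank_range_wedgeMap_hbox_pattern (hn : 0 < n)`): for `v = Σ_{α,β} c_{αβ} · E_{A_α} ∧ E_{C_β}` with ANY `c` (zeros allowed),
`finrank range(θ ↦ θ ∧ v ∣ ⋀ⁿ(K^{4n})) = N(c)·(C(2n,n) − 2) + 2·rank(c)`, `N(c) = #{(α,β) : c_{αβ} ≠ 0}` (every field, every `n ≥ 1`); it CONTAINS Part V
(`…_pattern_generic`: all four non-zero) and closes the rows without exceptional locus: `…_hbox_one_zero` (exactly one zero ⇒ `rank + 2 = 3·C(2n,n)`),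
`…_hbox_antidiag` (pure Weil pair), `…_hbox_row_zero` (one-sided rank-one h-part).  Mechanism (sign-free): live mixed monomials give `N(c)` classes of
`C(2n,n) − 2` independent single-term images; the four whole blocks map into the two triple-monomial planes with `2 × 2` coefficient matrices of rank
`rank(c)`; the three pieces sit on disjoint sets of basis monomials.  This file (sections Corners + Count): the corner spans are row spaces of explicit `2 × 2` matrices of rank `rank(c)` (`MA`, `MC`, `finrank_range_hbox_eq_card_add`), the count `#JMc = N(c)·(C(2n,n) − 2)`, **`finrank_range_wedgeMap_hbox_pattern`**, `_one_zero`, `_pattern_generic`, `_antidiag`, `_row_zero`.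
-/

open Module Set Set.powersetCard

namespace Summit.Ventures.HSemireg.WedgeBox

variable (K : Type*) [Field K] {n : ℕ}

section GeneralPattern

variable {k : ℕ} (c : Fin 2 → Fin 2 → K)

/-! #### The corner spans are the row spaces of explicit `2 × 2` matrices of rank `rank(c)`. -/

section Corners

variable (c : Fin 2 → Fin 2 → K)

/-- coefficient matrix of `(E_{A_0} ∧ v, E_{A_1} ∧ v)` in the basis `(E_{TA 0}, E_{TA 1})`. -/
noncomputable def MA : Matrix (Fin 2) (Fin 2) K :=
  Matrix.of fun a β => (if a = 0 then (1 : K) else (-1 : K) ^ (n * n)) * c (other a) β * uA K (n := n) β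

/-- coefficient matrix of `(E_{C_0} ∧ v, E_{C_1} ∧ v)` in the basis `(E_{TC 0}, E_{TC 1})`. -/
noncomputable def MC : Matrix (Fin 2) (Fin 2) K :=
  Matrix.of fun b α => (if b = 0 then (1 : K) else (-1 : K) ^ (n * n)) * c α (other b) * uC K (n := n) α

/-- `E_{A a} ∧ hbox c` written in the two `A`-side triple monomials with coefficient row `MA c a`. -/
lemma vA_eq_sum (hn : 0 < n) (a : Fin 2) :
    B K n (Apc n a : powersetCard (I n) n) * hbox K n c = ∑ β, MA K (n := n) c a β • B K n (TA n β) := by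
  fin_cases a
  · rw [show ((⟨0, by norm_num⟩ : Fin 2)) = 0 from rfl, vA_zero_eq K hn c]
    refine Finset.sum_congr rfl fun β _ => ?_
    congr 1
    rw [MA, Matrix.of_apply, if_pos rfl, other_zero, one_mul]
  · rw [show ((⟨1, by norm_num⟩ : Fin 2)) = 1 from rfl, vA_one_eq K hn c]
    refine Finset.sum_congr rfl fun β _ => ?_
    congr 1

/-- `E_{C b} ∧ hbox c` written in the two `C`-side triple monomials with coefficient row `MC c b`. -/
lemma vC_eq_sum (hn : 0 < n) (b : Fin 2) :
    B K n (Cpc n b : powersetCard (I n) n) * hbox K n c = ∑ α, MC K (n := n) c b α • B K n (TC n α) := by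
  fin_cases b
  · rw [show ((⟨0, by norm_num⟩ : Fin 2)) = 0 from rfl, vC_zero_eq K hn c]
    refine Finset.sum_congr rfl fun α _ => ?_
    congr 1
    rw [MC, Matrix.of_apply, if_pos rfl, other_zero, one_mul]
  · rw [show ((⟨1, by norm_num⟩ : Fin 2)) = 1 from rfl, vC_one_eq K hn c]
    refine Finset.sum_congr rfl fun α _ => ?_
    congr 1

/-- `dim` of the span of the rows of a matrix pushed through an injective-on-span linear combination map = its rank. -/
lemma finrank_span_rows_comb {ι : Type*} [Fintype ι] (e : ι → HT K n)
    (hinj : ∀ x : ι → K, (∑ i, x i • e i) = 0 → x = 0) (M : Matrix (Fin 2) ι K) :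
    Module.finrank K (Submodule.span K (Set.range fun a : Fin 2 => ∑ i, M a i • e i)) = M.rank := by
  have hT : (Submodule.span K (Set.range fun a : Fin 2 => ∑ i, M a i • e i)) =
      (Submodule.span K (Set.range M.row)).map (Fintype.linearCombination K e) := by
    rw [Submodule.map_span, ← Set.range_comp]
    rfl
  rw [hT, Matrix.rank_eq_finrank_span_row]
  have hinj' : Function.Injective ((Fintype.linearCombination K e).comp
      (Submodule.span K (Set.range M.row)).subtype) := by
    rw [← LinearMap.ker_eq_bot, LinearMap.ker_eq_bot']
    rintro ⟨x, hx⟩ hx0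
    exact Subtype.ext (hinj x hx0)
  rw [← LinearMap.finrank_range_of_inj hinj', LinearMap.range_comp, Submodule.range_subtype]

/-- the two `A`-side triple monomials are linearly independent (`n > 0`). -/
lemma TA_comb_injective (hn : 0 < n) (x : Fin 2 → K) (hx : (∑ β, x β • B K n (TA n β)) = 0) : x = 0 := by
  funext β
  have := coord_TA_sum_TA K hn x β
  rw [hx, map_zero] at this
  exact this.symm

/-- the two `C`-side triple monomials are linearly independent (`n > 0`). -/
lemma TC_comb_injective (hn : 0 < n) (x : Fin 2 → K) (hx : (∑ α, x α • B K n (TC n α)) = 0) : x = 0 := by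
  funext α
  have := coord_TC_sum_TC K hn x α
  rw [hx, map_zero] at this
  exact this.symm

/-- `dim RA c = rank (MA c)`. -/
lemma finrank_RA (hn : 0 < n) : Module.finrank K (RA K (n := n) c) = (MA K (n := n) c).rank := by
  have h : RA K (n := n) c = Submodule.span K (Set.range fun a : Fin 2 => ∑ β, MA K (n := n) c a β • B K n (TA n β)) := by
    rw [RA]
    congr 1
    ext x
    simp only [Set.mem_range, vA_eq_sum K c hn]
  rw [h]
  exact finrank_span_rows_comb K _ (TA_comb_injective K hn) _

/-- `dim RC c = rank (MC c)`. -/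
lemma finrank_RC (hn : 0 < n) : Module.finrank K (RC K (n := n) c) = (MC K (n := n) c).rank := by
  have h : RC K (n := n) c = Submodule.span K (Set.range fun b : Fin 2 => ∑ α, MC K (n := n) c b α • B K n (TC n α)) := by
    rw [RC]
    congr 1
    ext x
    simp only [Set.mem_range, vC_eq_sum K c hn]
  rw [h]
  exact finrank_span_rows_comb K _ (TC_comb_injective K hn) _

/-- the row-sign diagonal `diag(1, (−1)^{n·n})`. -/
noncomputable def dsgn : Fin 2 → K := fun a => if a = 0 then (1 : K) else (-1 : K) ^ (n * n)

/-- the diagonal signs `dsgn a ∈ {1, (−1)^{n·n}}` are non-zero. -/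
lemma dsgn_ne_zero (a : Fin 2) : dsgn (K := K) (n := n) a ≠ 0 := by
  unfold dsgn
  split_ifs
  · exact one_ne_zero
  · exact pow_ne_zero _ (neg_ne_zero.mpr one_ne_zero)

/-- the swap of the two indices, as an equivalence. -/
def oeq : Fin 2 ≃ Fin 2 := ⟨other, other, other_other, other_other⟩

/-- the swap equivalence `oeq` of `Fin 2` acts by `other` (definitional). -/
@[simp] lemma oeq_apply (a : Fin 2) : oeq a = other a := rfl

/-- `MA c = diag(dsgn) · (row-swapped c) · diag(units)` as an explicit matrix product. -/
lemma MA_eq : MA K (n := n) c =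
    Matrix.diagonal (dsgn (K := K) (n := n)) * (Matrix.of c).submatrix oeq (Equiv.refl (Fin 2)) *
      Matrix.diagonal (uA K (n := n)) := by
  ext a β
  rw [Matrix.mul_diagonal, Matrix.diagonal_mul, Matrix.submatrix_apply, Equiv.refl_apply, oeq_apply,
    Matrix.of_apply, MA, Matrix.of_apply]
  rfl

/-- `MC c = diag(dsgn) · (row-swapped cᵀ) · diag(units)` as an explicit matrix product. -/
lemma MC_eq : MC K (n := n) c =
    Matrix.diagonal (dsgn (K := K) (n := n)) * (Matrix.of c).transpose.submatrix oeq (Equiv.refl (Fin 2)) *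
      Matrix.diagonal (uC K (n := n)) := by
  ext b α
  rw [Matrix.mul_diagonal, Matrix.diagonal_mul, Matrix.submatrix_apply, Equiv.refl_apply, oeq_apply,
    Matrix.transpose_apply, Matrix.of_apply, MC, Matrix.of_apply]
  rfl

/-- a `2 × 2` diagonal matrix with non-zero entries has unit determinant. -/
lemma isUnit_det_diagonal {d : Fin 2 → K} (hd : ∀ a, d a ≠ 0) : IsUnit (Matrix.diagonal d).det := by
  rw [Matrix.det_diagonal, isUnit_iff_ne_zero, Finset.prod_ne_zero_iff]
  exact fun a _ => hd a

/-- `rank (MA c) = rank c`. -/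
lemma rank_MA : (MA K (n := n) c).rank = (Matrix.of c).rank := by
  rw [MA_eq, Matrix.rank_mul_eq_left_of_isUnit_det _ _ (isUnit_det_diagonal K (uA_ne_zero K)),
    Matrix.rank_mul_eq_right_of_isUnit_det _ _ (isUnit_det_diagonal K (dsgn_ne_zero K)),
    Matrix.rank_submatrix]

/-- `rank (MC c) = rank c`. -/
lemma rank_MC : (MC K (n := n) c).rank = (Matrix.of c).rank := by
  rw [MC_eq, Matrix.rank_mul_eq_left_of_isUnit_det _ _ (isUnit_det_diagonal K (uC_ne_zero K)),
    Matrix.rank_mul_eq_right_of_isUnit_det _ _ (isUnit_det_diagonal K (dsgn_ne_zero K)),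
    Matrix.rank_submatrix, Matrix.rank_transpose]

/-- STRUCTURE OF THE RANGE, second form: `dim = #(live mixed) + 2·rank(c)`. -/
theorem finrank_range_hbox_eq_card_add (hn : 0 < n) :
    Module.finrank K (LinearMap.range (wedgeMap K n n (hbox K n c))) =
      (JMc K (n := n) c).card + 2 * (Matrix.of c).rank := by
  rw [finrank_range_hbox_eq_three K c hn, finrank_RA K c hn, finrank_RC K c hn, rank_MA, rank_MC]
  ring

end Corners

/-! #### Counting the live mixed monomials: `#JMc = N(c) · (C(2n,n) − 2)`. -/

section Count

variable (c : Fin 2 → Fin 2 → K)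

open Classical in
/-- the number of non-zero entries of `c`. -/
noncomputable def nnz : ℕ := (Finset.univ.filter fun p : Fin 2 × Fin 2 => c p.1 p.2 ≠ 0).card

open Classical in
/-- the number of non-zero entries `nnz c` as a sum of indicators over `Fin 2 × Fin 2`. -/
lemma nnz_eq_sum : nnz K c = ∑ p : Fin 2 × Fin 2, (if c p.1 p.2 ≠ 0 then 1 else 0) := by
  rw [nnz, Finset.card_filter]

open Classical in
/-- the same indicator sum re-indexed by the involution `other × other`. -/
lemma nnz_eq_sum_other : nnz K c = ∑ p : Fin 2 × Fin 2, (if c (other p.1) (other p.2) ≠ 0 then 1 else 0) := by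
  rw [nnz_eq_sum, Fintype.sum_prod_type, Fintype.sum_prod_type]
  simp only [Fin.sum_univ_two, other_zero, other_one]
  ring

/-- `2 ≤ C(2n,n)` for `n > 0`. -/
lemma two_le_choose (hn : 0 < n) : 2 ≤ (n + n).choose n := by
  have := card_Mix (n := n) (k := n) hn (0, 0)
  rw [Nat.choose_self] at this
  omega

open Classical in
/-- THE COUNT `#JMc c = nnz(c) · (C(2n,n) − 2)` (`n > 0`). -/
lemma card_JMc (hn : 0 < n) : (JMc K (n := n) c).card = nnz K c * ((n + n).choose n - 2) := by
  have hfilter : ∀ p : Fin 2 × Fin 2, ((Mix n n p).filter fun s => c (αc s) (βc s) ≠ 0) =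
      if c (other p.1) (other p.2) ≠ 0 then Mix n n p else ∅ := by
    intro p
    split_ifs with h
    · refine Finset.filter_true_of_mem fun s hs => ?_
      rw [(canon_of_mem_Mix hs).1, (canon_of_mem_Mix hs).2]
      exact h
    · refine Finset.filter_false_of_mem fun s hs => ?_
      rw [(canon_of_mem_Mix hs).1, (canon_of_mem_Mix hs).2]
      exact h
  have hcard : ∀ p : Fin 2 × Fin 2, (Mix n n p).card = (n + n).choose n - 2 := by
    intro p
    have := card_Mix (n := n) (k := n) hn p
    rw [Nat.choose_self] at this
    omega
  unfold JMc JM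
  rw [Finset.filter_biUnion, Finset.card_biUnion]
  · simp_rw [hfilter]
    rw [nnz_eq_sum_other, Finset.sum_mul]
    refine Finset.sum_congr rfl fun p _ => ?_
    split_ifs with h
    · rw [hcard, one_mul]
    · rw [Finset.card_empty, zero_mul]
  · intro p _ q _ hpq
    exact Finset.disjoint_filter_filter ((Mix_pairwiseDisjoint (n := n) (k := n)) (Finset.mem_coe.mpr (Finset.mem_univ p))
      (Finset.mem_coe.mpr (Finset.mem_univ q)) hpq)

/-- **THE DEGREE-`n` RANK FOR AN ARBITRARY COEFFICIENT PATTERN** (wedge model, every field, every `n ≥ 1`): for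
`v = Σ_{α,β} c_{αβ} · E_{A_α} ∧ E_{C_β}` with ANY `2 × 2` matrix `c`,
`dim range(θ ↦ θ ∧ v ∣ ⋀^n(K^{4n})) = N(c) · (C(2n,n) − 2) + 2 · rank(c)`, `N(c)` = number of non-zero entries of `c`. -/
theorem finrank_range_wedgeMap_hbox_pattern (hn : 0 < n) :
    Module.finrank K (LinearMap.range (wedgeMap K n n (hbox K n c))) =
      nnz K c * ((n + n).choose n - 2) + 2 * (Matrix.of c).rank := by
  rw [finrank_range_hbox_eq_card_add K c hn, card_JMc K c hn]

/-! #### Closed corollaries: exactly one zero entry ⇒ `3·C(2n,n) − 2`, no exceptional locus. -/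

/-- exactly one zero entry ⇒ `nnz c = 3`. -/
lemma nnz_three {α₀ β₀ : Fin 2} (h0 : c α₀ β₀ = 0) (hc : ∀ α β, (α, β) ≠ (α₀, β₀) → c α β ≠ 0) :
    nnz K c = 3 := by
  rw [nnz_eq_sum, Fintype.sum_prod_type]
  simp only [Fin.sum_univ_two]
  by_cases hα : α₀ = 0
  · subst hα
    by_cases hβ : β₀ = 0
    · subst hβ
      rw [if_neg (not_not.mpr h0), if_pos (hc 0 1 (by decide)), if_pos (hc 1 0 (by decide)),
        if_pos (hc 1 1 (by decide))]
      rfl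
    · obtain rfl : β₀ = 1 := by omega
      rw [if_pos (hc 0 0 (by decide)), if_neg (not_not.mpr h0), if_pos (hc 1 0 (by decide)),
        if_pos (hc 1 1 (by decide))]
      rfl
  · obtain rfl : α₀ = 1 := by omega
    by_cases hβ : β₀ = 0
    · subst hβ
      rw [if_pos (hc 0 0 (by decide)), if_pos (hc 0 1 (by decide)), if_neg (not_not.mpr h0),
        if_pos (hc 1 1 (by decide))]
      rfl
    · obtain rfl : β₀ = 1 := by omega
      rw [if_pos (hc 0 0 (by decide)), if_pos (hc 0 1 (by decide)), if_pos (hc 1 0 (by decide)),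
        if_neg (not_not.mpr h0)]
      rfl

/-- exactly one zero entry ⇒ `det c ≠ 0`. -/
lemma det_ne_zero_of_one_zero {α₀ β₀ : Fin 2} (h0 : c α₀ β₀ = 0)
    (hc : ∀ α β, (α, β) ≠ (α₀, β₀) → c α β ≠ 0) : c 0 0 * c 1 1 - c 0 1 * c 1 0 ≠ 0 := by
  by_cases hα : α₀ = 0
  · subst hα
    by_cases hβ : β₀ = 0
    · subst hβ
      rw [h0, zero_mul, zero_sub, neg_ne_zero]
      exact mul_ne_zero (hc 0 1 (by decide)) (hc 1 0 (by decide))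
    · obtain rfl : β₀ = 1 := by omega
      rw [h0, zero_mul, sub_zero]
      exact mul_ne_zero (hc 0 0 (by decide)) (hc 1 1 (by decide))
  · obtain rfl : α₀ = 1 := by omega
    by_cases hβ : β₀ = 0
    · subst hβ
      rw [h0, mul_zero, sub_zero]
      exact mul_ne_zero (hc 0 0 (by decide)) (hc 1 1 (by decide))
    · obtain rfl : β₀ = 1 := by omega
      rw [h0, mul_zero, zero_sub, neg_ne_zero]
      exact mul_ne_zero (hc 0 1 (by decide)) (hc 1 0 (by decide))

/-- `det c ≠ 0` ⇒ `rank c = 2`. -/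
lemma rank_two_of_det_ne_zero (h : c 0 0 * c 1 1 - c 0 1 * c 1 0 ≠ 0) : (Matrix.of c).rank = 2 := by
  have hdet : IsUnit (Matrix.of c).det := by
    rw [Matrix.det_fin_two, isUnit_iff_ne_zero]
    exact h
  rw [Matrix.rank_of_isUnit _ ((Matrix.isUnit_iff_isUnit_det _).mpr hdet), Fintype.card_fin]

/-- **EXACTLY ONE ZERO COEFFICIENT**: `rank + 2 = 3·C(2n,n)` — NO exceptional locus (models: the rank-one h-part
`c₁e^{λΘ} + a·vol U₊ + b·vol U₋`, and the one-sided two-exponential class `c₁e^{λΘ} + c₂e^{μΘ} + b·vol U₋`). -/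
theorem finrank_range_wedgeMap_hbox_one_zero (hn : 0 < n) {α₀ β₀ : Fin 2} (h0 : c α₀ β₀ = 0)
    (hc : ∀ α β, (α, β) ≠ (α₀, β₀) → c α β ≠ 0) :
    Module.finrank K (LinearMap.range (wedgeMap K n n (hbox K n c))) + 2 = 3 * (n + n).choose n := by
  rw [finrank_range_wedgeMap_hbox_pattern K c hn, nnz_three K c h0 hc,
    rank_two_of_det_ne_zero K c (det_ne_zero_of_one_zero K c h0 hc)]
  have := two_le_choose (n := n) hn
  omega

/-- consistency with Part V off the determinant locus (all four entries non-zero): `rank + 4 = 4·C(2n,n)`. -/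
theorem finrank_range_wedgeMap_hbox_pattern_generic (hn : 0 < n) (hc : ∀ α β, c α β ≠ 0)
    (hdet : c 0 0 * c 1 1 - c 0 1 * c 1 0 ≠ 0) :
    Module.finrank K (LinearMap.range (wedgeMap K n n (hbox K n c))) + 4 = 4 * (n + n).choose n := by
  have hN : nnz K c = 4 := by
    rw [nnz_eq_sum, Fintype.sum_prod_type]
    simp only [Fin.sum_univ_two]
    rw [if_pos (hc 0 0), if_pos (hc 0 1), if_pos (hc 1 0), if_pos (hc 1 1)]
    rfl
  rw [finrank_range_wedgeMap_hbox_pattern K c hn, hN, rank_two_of_det_ne_zero K c hdet]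
  have := two_le_choose (n := n) hn
  omega

/-! #### Two-zero patterns spelled out (pure Weil pair; one-sided rank-one h-part). -/

/-- the antidiagonal pattern (`c₀₀ = c₁₁ = 0`, `c₀₁c₁₀ ≠ 0`) has `nnz c = 2`. -/
lemma nnz_two_antidiag (h00 : c 0 0 = 0) (h11 : c 1 1 = 0) (h01 : c 0 1 ≠ 0) (h10 : c 1 0 ≠ 0) :
    nnz K c = 2 := by
  rw [nnz_eq_sum, Fintype.sum_prod_type]
  simp only [Fin.sum_univ_two]
  rw [if_neg (not_not.mpr h00), if_pos h01, if_pos h10, if_neg (not_not.mpr h11)]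
  rfl

/-- the first-row pattern (`c₁₀ = c₁₁ = 0`, `c₀₀c₀₁ ≠ 0`) has `nnz c = 2`. -/
lemma nnz_two_row (h10 : c 1 0 = 0) (h11 : c 1 1 = 0) (h00 : c 0 0 ≠ 0) (h01 : c 0 1 ≠ 0) :
    nnz K c = 2 := by
  rw [nnz_eq_sum, Fintype.sum_prod_type]
  simp only [Fin.sum_univ_two]
  rw [if_pos h00, if_pos h01, if_neg (not_not.mpr h10), if_neg (not_not.mpr h11)]
  rfl

/-- a `2 × 2` matrix with zero second row and non-zero first row has rank one. -/
lemma rank_one_of_row_zero (h10 : c 1 0 = 0) (h11 : c 1 1 = 0) (h00 : c 0 0 ≠ 0) :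
    (Matrix.of c).rank = 1 := by
  have hrow : Set.range (Matrix.of c).row = {c 0, 0} := by
    have h1 : c 1 = 0 := by
      funext β
      by_cases hβ : β = 0
      · subst hβ; exact h10
      · obtain rfl : β = 1 := by omega
        exact h11
    ext x
    simp only [Set.mem_range, Set.mem_insert_iff, Set.mem_singleton_iff]
    constructor
    · rintro ⟨a, rfl⟩
      by_cases ha : a = 0
      · subst ha; exact Or.inl rfl
      · obtain rfl : a = 1 := by omega
        right; exact h1
    · rintro (rfl | rfl)
      · exact ⟨0, rfl⟩
      · exact ⟨1, h1⟩
  have hc0 : c 0 ≠ 0 := fun h => h00 (by rw [h]; rfl)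
  rw [Matrix.rank_eq_finrank_span_row, hrow, Submodule.span_insert, Submodule.span_zero_singleton, sup_bot_eq]
  exact finrank_span_singleton hc0

/-- ANTIDIAGONAL pattern (model of the PURE WEIL PAIR `a·vol U₊ + b·vol U₋`): `rank = 2·C(2n,n)`. -/
theorem finrank_range_wedgeMap_hbox_antidiag (hn : 0 < n) (h00 : c 0 0 = 0) (h11 : c 1 1 = 0) (h01 : c 0 1 ≠ 0)
    (h10 : c 1 0 ≠ 0) :
    Module.finrank K (LinearMap.range (wedgeMap K n n (hbox K n c))) = 2 * (n + n).choose n := by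
  have hdet : c 0 0 * c 1 1 - c 0 1 * c 1 0 ≠ 0 := by
    rw [h00, zero_mul, zero_sub, neg_ne_zero]; exact mul_ne_zero h01 h10
  rw [finrank_range_wedgeMap_hbox_pattern K c hn, nnz_two_antidiag K c h00 h11 h01 h10,
    rank_two_of_det_ne_zero K c hdet]
  have := two_le_choose (n := n) hn
  omega

/-- ZERO SECOND ROW (model of the ONE-SIDED rank-one h-part `c₁e^{λΘ} + a·vol U₊`): `rank + 2 = 2·C(2n,n)`. -/
theorem finrank_range_wedgeMap_hbox_row_zero (hn : 0 < n) (h10 : c 1 0 = 0) (h11 : c 1 1 = 0) (h00 : c 0 0 ≠ 0)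
    (h01 : c 0 1 ≠ 0) :
    Module.finrank K (LinearMap.range (wedgeMap K n n (hbox K n c))) + 2 = 2 * (n + n).choose n := by
  rw [finrank_range_wedgeMap_hbox_pattern K c hn, nnz_two_row K c h10 h11 h00 h01,
    rank_one_of_row_zero K c h10 h11 h00]
  have := two_le_choose (n := n) hn
  omega

end Count

end GeneralPattern

end Summit.Ventures.HSemireg.WedgeBox
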